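import Summits.PneNP.PneNP.Theorems.ConvexRankGatesConvexGateBlindStubPerfectCompletenessSos
import Summits.PneNP.PneNP.Theorems.ConvexRankGatesConvexGateBlindStubPerfectCompletenessHoneycombIso

/-!
# Perfect completeness of SA+SOS at every degree — assembled, definition-free form
(helper for stub `stub_perfectCompleteness` of line `xor-door-perfect-completeness`, crux `ConvexGateBlind`,
item stmt-PneNP-10680; registered sub-goal `stub_perfectCompleteness_main`)

`stub_perfectCompleteness_main` is the line's statement `PerfectCompleteness` with the shared
vocabulary (`Pool`, `Sat`, `viol`, `IsJunta`, `HasPerfectPseudoExp` of `…XorDefs`) UNFOLDED, and the last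
clause in the stronger per-equation form `Ẽ [e violated] = 0` for every `e ∈ F`: for every degree `d`
there is an unsatisfiable 3-sparse XOR system `F` on `m` variables and a linear functional `Ẽ` on real
functions of `𝔽₂^m`, non-negative on non-negative `d`-juntas and on squares of combinations of
`d/2`-juntas, with `Ẽ 1 = 1`, vanishing on every violation indicator. The instance is the Tseitin
contradiction on the `n × n` honeycomb torus, `n = 6d + 6` (`…Honeycomb{,Iso}`), the functional is
Grigoriev's (`…Functional`, `…Sos`) at scale `K = 12(d+1)² - 1` (`3K < n²`, `d n ≤ K`, `2d < n`).
Sources: Grigoriev, *Theoret. Comput. Sci.* 259 (2001) 613–622; Schoenebeck, FOCS 2008, Thm 1. The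
10-line wrapper `stub_perfectCompleteness : PerfectCompleteness` lives in `…StubPerfectCompleteness`
(it only needs the shared definitions file).
-/

set_option linter.dupNamespace false -- `Summit.PneNP.PneNP.…`: summit = sub-problem (D-0017)

namespace Summit.PneNP.PneNP.Theorems.XorDoor.PC

open Finset

noncomputable section

/-- The isoperimetric hypotheses of Grigoriev's functional hold for the honeycomb torus of side
`n = 6d + 6` at scale `K = 12(d+1)² - 1` and degree `d`. [folklore] -/
theorem isoHyp_honeycomb (d : ℕ) {n : ℕ} [NeZero n] (hn : n = 6 * d + 6) :
    IsoHyp (hcA n) (12 * d * d + 24 * d + 11) d := by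
  have hev : Even n := ⟨3 * d + 3, by omega⟩
  have hnn : Fintype.card (Fin n × Fin n) = (6 * d + 6) * (6 * d + 6) := by
    rw [Fintype.card_prod, Fintype.card_fin, hn]
  have hdn : d * n = 6 * d * d + 6 * d := by rw [hn]; ring
  have hn2 : n * n = (6 * d + 6) * (6 * d + 6) := by rw [hn]
  refine ⟨?_, by omega, fun T hT => ?_, fun T hT => honeycomb_conn hev T hT⟩
  · rw [hnn]
    nlinarith
  · rcases honeycomb_iso hev T hT (by omega) with h | h
    · left
      rw [hdn] at h
      nlinarith
    · right
      rw [hnn]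
      rw [hdn, hn2] at h
      nlinarith

/-- An equation of the honeycomb system holds iff the character of its three variables has the sign
of its charge. [folklore] -/
theorem sum_eq_iff_chi {n : ℕ} [NeZero n] (hn : Even n) (y : Fin (n * n + n * n) → ZMod 2)
    (v : Fin n × Fin n) :
    y (hE n v) + y (hL n v) + y (vert n v) = hcC n v ↔ chi (hcA n v) y = sgn (hcC n v) := by
  rw [chi_hcA hn, sgn_eq_sgn_iff]

/-- Registered sub-goal `stub_perfectCompleteness_main` of stub `stub_perfectCompleteness`
(**perfect completeness at every degree**, `PerfectCompleteness` with the shared definitions unfolded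
and the violation clause per equation): for every `d`, the Tseitin contradiction on the
`(6d+6) × (6d+6)` honeycomb torus is an unsatisfiable 3-sparse XOR system carrying a degree-`d`
perfect-completeness Sherali–Adams + SOS pseudo-expectation (Grigoriev 2001; Schoenebeck 2008).
[folklore] -/
theorem stub_perfectCompleteness_main : ∀ d : ℕ, ∃ (m : ℕ) (F : Finset (Fin m × Fin m × Fin m × ZMod 2)),
    (¬ ∃ y : Fin m → ZMod 2, ∀ e ∈ F, y e.1 + y e.2.1 + y e.2.2.1 = e.2.2.2) ∧
    ∃ E : ((Fin m → ZMod 2) → ℝ) →ₗ[ℝ] ℝ,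
      (∀ h : (Fin m → ZMod 2) → ℝ, (∃ S : Finset (Fin m), S.card ≤ d ∧
          ∀ x y : Fin m → ZMod 2, (∀ i ∈ S, x i = y i) → h x = h y) → (∀ x, 0 ≤ h x) → 0 ≤ E h) ∧
      (∀ s : (Fin m → ZMod 2) → ℝ, s ∈ Submodule.span ℝ {f : (Fin m → ZMod 2) → ℝ |
          ∃ S : Finset (Fin m), S.card ≤ d / 2 ∧
            ∀ x y : Fin m → ZMod 2, (∀ i ∈ S, x i = y i) → f x = f y} → 0 ≤ E (s * s)) ∧
      E (fun _ => 1) = 1 ∧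
      ∀ e ∈ F, E (fun y => if y e.1 + y e.2.1 + y e.2.2.1 = e.2.2.2 then 0 else 1) = 0 := by
  intro d
  obtain ⟨n, hn⟩ : ∃ n : ℕ, n = 6 * d + 6 := ⟨_, rfl⟩
  haveI : NeZero n := ⟨by omega⟩
  have hev : Even n := ⟨3 * d + 3, by omega⟩
  have hIso := isoHyp_honeycomb d hn
  refine ⟨n * n + n * n, univ.image fun v : Fin n × Fin n => (hE n v, hL n v, vert n v, hcC n v),
    ?_, func (hcA n) (hcC n) (12 * d * d + 24 * d + 11), ?_, ?_, hIso.func_one (hcC n), ?_⟩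
  · rintro ⟨y, hy⟩
    exact honeycomb_unsat hev ⟨y, fun v => hy _ (mem_image_of_mem _ (mem_univ v))⟩
  · rintro h ⟨U, hU, hdep⟩ hpos
    exact hIso.func_nonneg_of_junta (hcC n) hU hdep hpos
  · intro s hs
    exact hIso.func_mul_self_nonneg (hcC n) (k := d / 2) (by omega)
      fun T hT => coeff_eq_zero_of_mem_span hs hT
  · intro e he
    obtain ⟨v, -, rfl⟩ := mem_image.1 he
    convert hIso.func_violInd (hcC n) v using 2
    funext y
    simp only [sum_eq_iff_chi hev]

end

end Summit.PneNP.PneNP.Theorems.XorDoor.PC
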